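import Summits.BirchSwinnertonDyer.BirchSwinnertonDyer.Theorems.ManinLocalTwoThreeEulerRemaindersOneTwentyEight
import Summits.BirchSwinnertonDyer.BirchSwinnertonDyer.Theorems.ManinLocalTwoThreeEtaPowersNinetySixB
import Summits.BirchSwinnertonDyer.BirchSwinnertonDyer.Theorems.ManinLocalTwoThreeEtaPowersOneTwentyEightA
import HarnessLib

/-!
# Level 128 (class `96c`), the `q`-toolkit III: powers `E_δ^e` reduced modulo `X³⁴`

Cell bsd-f2-manin, route `ManinLocalTwoThree` (crux C2 `ManinOddAtFour` stmt-22967: `2² ∣ 128`; `128 = 2⁷`, `v₂(N) = 7` — the deepest `2`-adic cell of the charter's "no semistable partner" range; genus `9`, four newforms `128a–d`), prover seat p3 gen 24.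
Class `128c` (`128c1 = [0, -1, 0, 1, -1] : y² = x³ − x² + x − 1`, full rational `2`-torsion): `𝓧 = x` is the single `η`-quotient
`etaQuotient 128 (expFn [(2, 2), (4, -3), (8, 1), (16, -1), (32, 3), (64, -2)])` (`Γ₀(128)`-invariant), `𝓨 = η(expFn [(2, 2), (4, -5), (8, 3), (16, 1), (32, 1), (64, -2)])` satisfies `x′ = −2πiφ·2𝓨`, `𝓨² = x³ − x² + x − 1`, and
`φ₁₂₈c = -4B1 − 2B2 + 4B3 + 2B4 + B5 + 2B6` on an-g51's `η`-basis `B₁…B₅` of the new part (cell HOME/an/g51 `newform-coords-D.out`; the PINNING `⇑D.f = φ₁₂₈c` is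
NOT proved here).  THE E₂ ROAD (`EtaLogDerivativeForms`): `𝓧′ = (πi/12)G_𝓧𝓧`, `𝓨′ = (πi/12)G_𝓨𝓨`; `A_j = B_jη(r_𝓨)/𝓧`,
`C_j^{(2)} = B_j𝓧²/η(r_𝓨)`, `C_j^{(1)} = B_j𝓧/η(r_𝓨)`, `C_j^{(0)} = B_j/η(r_𝓨)` are INDIVIDUALLY HOLOMORPHIC weight-`2` `η`-quotients on `Γ₀(128)`
(Ligozat orders, `decide`), so (I2a), (I2b) are LINEAR relations in `M₂(Γ₀(128))` settled by Sturm (`μ = 192`, `⌊2·192/12⌋ + 1 = 33`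
coefficients).
Each power of an Euler function occurring in the cleared identities is reduced modulo `X³⁴` once (explicit quotient witness, `ring`), so that
every later kernel identity stays small. Pure bookkeeping. Nothing here proves C2, Manin's conjecture or BSD; the other classes (`128b`, `128d` have no single η-quotient `y`) and the newform PINNING at `128` are separate; item 22967 stays OPEN. [cite: Ligozat1975, Ch. 3]
-/

set_option autoImplicit false
-- lint-debt: the directory name repeats the summit name (sibling precedent `ManinLocalTwoThreeEtaPowersOneHundredEight.lean`)
set_option linter.dupNamespace false

noncomputable section

open Complex Filter Topology Set Asymptotics Polynomial EisensteinSeries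
open UpperHalfPlane hiding I
open scoped Real Topology Manifold MatrixGroups ModularForm
open ModularForm CongruenceSubgroup
open Literature.NumberTheory.ModularForms
open Literature.NumberTheory.EllipticCurves Literature.NumberTheory.EllipticCurves.ModularForms

namespace Summit.BirchSwinnertonDyer.BirchSwinnertonDyer.Theorems.ManinLocalTwoThree.EtaPowersOneTwentyEightC

open QRemainder EulerRemainders EulerRemaindersNinetySix EulerRemaindersOneTwentyEight LevelFortyFour EtaPowersNinetySixA EtaPowersNinetySixA2 EtaPowersNinetySixB EtaPowersOneTwentyEightA

/-- `E4^10` reduced modulo `X³⁴` (as `E4^5·E4^5`). [folklore] -/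
theorem pow_E4_10 :
    Tendsto (fun τ : ℍ ↦ (eulerFn 4 τ ^ 10 - (1 - 10 * X ^ 4 + 35 * X ^ 8 - 30 * X ^ 12 - 105 * X ^ 16 + 238 * X ^ 20 - 260 * X ^ 28 - 165 * X ^ 32 : ℂ[X]).eval (Function.Periodic.qParam 1 (τ : ℂ))) / Function.Periodic.qParam 1 (τ : ℂ) ^ 33) atImInfty (𝓝 0) :=
  QRemainder.congr_fun (fun τ ↦ by ring) (QRemainder.reduce (1 - 10 * X ^ 4 + 35 * X ^ 8 - 30 * X ^ 12 - 105 * X ^ 16 + 238 * X ^ 20 - 260 * X ^ 28 - 165 * X ^ 32)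
    (180 * X ^ 2 + 836 * X ^ 6 - 390 * X ^ 10 - 725 * X ^ 14 - 430 * X ^ 18 + 475 * X ^ 22 + 750 * X ^ 26 + 225 * X ^ 30)
    (by ring) (QRemainder.mul pow_E4_5 pow_E4_5))

end Summit.BirchSwinnertonDyer.BirchSwinnertonDyer.Theorems.ManinLocalTwoThree.EtaPowersOneTwentyEightC

end
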